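import Summits.RiemannHypothesis.RiemannHypothesis.Theses.WeilComb
import Summits.RiemannHypothesis.RiemannHypothesis.Theorems.WeilCombCombShapePositivityStubPoincareExplicit
import Summits.RiemannHypothesis.RiemannHypothesis.Theorems.WeilCombCombShapePositivityStubPolarCS
import Summits.RiemannHypothesis.RiemannHypothesis.Theorems.WeilCombCombHelsonBound
import Mathlib.NumberTheory.Harmonic.Bounds

/-!
# Stub `stub_subArith` of line `Sketch` for crux `WeilComb.CombShapePositivity`
(item stmt-RiemannHypothesis-11229, route route-RiemannHypothesis-WeilComb)

**Statement (explicit divisor-graph inequalities of the effective subcritical window).**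
For `a : ℕ → ℂ` and `M : ℕ` put `L = Σ_{m ≤ M} ‖a_m‖²`, `Q' = Σ_{m ≤ M} m log m ‖a_m‖²`,
`D = Σ_{m ≤ M} Σ_{n ≤ M/m} Λ(n) ‖a(nm) − n^{-1/2} a_m‖²` (Dirichlet energy of the von Mangoldt divisor
graph in the Perron gauge), `B_abs = Σ_m Σ_{m' ≠ m} ‖a_m‖ ‖a_{m'}‖ / |log m − log m'|` (absolute
log-Hilbert form), `A₋ = Σ ‖a_m‖/√m`, `A₊ = Σ ‖a_m‖ √m`, `ψ₁(y) = Σ_{n ≤ y} Λ(n)/n`. Then, for every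
`M` and `a`:

1. (multiscale Poincaré, explicit constant) `Q' ≤ 2M·D + 2(log 4 + 4)·M·L`;
2. (near-diagonal Schur bound) `B_abs ≤ 3M·L + 2Q'`;
3. (pole shadow, Cauchy–Schwarz twice) `(A₋ A₊)² ≤ 4M·L·(M·L + Q')`;
4. (Helson potential) `Σ_m ‖a_m‖² (log m + ψ₁(M/m)) ≤ (log M + 1)·L`.

**Proof.** (1) is the landed `WeilCombBohrFejer.stub_poincare_explicit` and (3) the landed
`WeilCombBohrFejer.stub_polarCS` (same statements). (2): AM–GM `‖a_m‖‖a_{m'}‖ ≤ (‖a_m‖² + ‖a_{m'}‖²)/2`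
and the symmetry of the kernel give `B_abs ≤ Σ_m ‖a_m‖² R_m` with the row sums
`R_m = Σ_{m' ≠ m} 1/|log m − log m'|`; from `log x − log y ≥ (x − y)/x` one has
`1/|log m − log m'| ≤ m/|m − m'| + 1`, so `R_m ≤ 2m(1 + log M) + M ≤ 3M + 2 m log m` (two harmonic
sums and `m (log M − log m) ≤ M − m`); adapted verbatim from the private theorem `offdiag_le` of
`Theorems/WeilCombCombSubcriticalStubCore.lean`. (4): termwise `log m + ψ₁(M/m) ≤ log M + 1` for
`1 ≤ m ≤ M` (`WeilComb.log_add_sum_vonMangoldt_div_le`, from Rosser–Schoenfeld 1962, (3.24) with (2.8):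
`ψ₁(y) < log y + 1` for `y ≥ 1`, `RosserSchoenfeld.sum_vonMangoldt_div_lt_log_add_one`), multiplied by
`‖a_m‖² ≥ 0` and summed (for `M = 0` all sums are empty).

Unconditional; standard axioms.
-/

noncomputable section

-- the sub-problem path `RiemannHypothesis/RiemannHypothesis` (single-conjunct summit, D-0017) duplicates a namespace
set_option linter.dupNamespace false

open scoped BigOperators ComplexConjugate
open Complex

namespace Summit.RiemannHypothesis.RiemannHypothesis.Theorems.WeilCombBohrFejer

open Literature.NumberTheory.LFunctions

/-! ### Row sums of the log-Hilbert kernel (adapted from `WeilCombCombSubcriticalStubCore.lean`) -/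

-- adapted from Theorems/WeilCombCombSubcriticalStubCore.lean (`sum_one_div_le_log`)
/-- A map `e : s → {0, …, M}`, injective off `e = 0`, bounds `Σ_{x ∈ s} 1/e(x)` (with `1/0 = 0`)
by the harmonic sum `Σ_{k ≤ M} 1/k ≤ 1 + log M`. -/
private theorem sum_one_div_le_log_subArith {s : Finset ℕ} {M : ℕ} (e : ℕ → ℕ)
    (hinj : ∀ x ∈ s, ∀ y ∈ s, e x ≠ 0 → e x = e y → x = y) (hmaps : ∀ x ∈ s, e x ≤ M) :
    ∑ x ∈ s, 1 / ((e x : ℕ) : ℝ) ≤ 1 + Real.log M := by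
  have hH := harmonic_le_one_add_log M
  simp_rw [harmonic_eq_sum_Icc, Rat.cast_sum, Rat.cast_inv, Rat.cast_natCast] at hH
  rw [← Finset.sum_filter_of_ne (p := fun x => e x ≠ 0)
    (fun x _ h h0 => h (by rw [h0, Nat.cast_zero, div_zero]))]
  have hinj' : Set.InjOn e ↑(s.filter fun x => e x ≠ 0) := by
    intro x hx y hy hxy
    simp only [Finset.coe_filter, Set.mem_setOf_eq] at hx hy
    exact hinj x hx.1 y hy.1 hx.2 hxy
  calc ∑ x ∈ s.filter (fun x => e x ≠ 0), 1 / ((e x : ℕ) : ℝ)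
      = ∑ k ∈ (s.filter fun x => e x ≠ 0).image e, 1 / (k : ℝ) :=
        (Finset.sum_image (f := fun k : ℕ => 1 / (k : ℝ)) hinj').symm
    _ ≤ ∑ k ∈ Finset.Icc 1 M, 1 / (k : ℝ) := by
        refine Finset.sum_le_sum_of_subset_of_nonneg (fun k hk => ?_) fun _ _ _ => by positivity
        simp only [Finset.mem_image, Finset.mem_filter] at hk
        obtain ⟨x, ⟨hx, hx0⟩, rfl⟩ := hk
        exact Finset.mem_Icc.mpr ⟨Nat.pos_of_ne_zero hx0, hmaps x hx⟩
    _ ≤ 1 + Real.log M := by simpa only [one_div] using hH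

-- adapted from Theorems/WeilCombCombSubcriticalStubCore.lean (`sub_div_le_log_sub_log`)
/-- For `x, y > 0`: `(x − y)/x ≤ log x − log y`. -/
private theorem sub_div_le_log_sub_log_subArith {x y : ℝ} (hx : 0 < x) (hy : 0 < y) :
    (x - y) / x ≤ Real.log x - Real.log y := by
  have h := Real.log_le_sub_one_of_pos (div_pos hy hx)
  rw [Real.log_div hy.ne' hx.ne'] at h
  rw [sub_div, div_self hx.ne']
  linarith

-- adapted from Theorems/WeilCombCombSubcriticalStubCore.lean (`inv_abs_log_sub_le`)
/-- For distinct positive integers: `1/|log m − log m'| ≤ m/|m − m'| + 1`. -/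
private theorem inv_abs_log_sub_le_subArith {m m' : ℕ} (hm : 1 ≤ m) (hm' : 1 ≤ m') (hne : m ≠ m') :
    1 / |Real.log m - Real.log m'| ≤ (m : ℝ) / |(m : ℝ) - m'| + 1 := by
  have hm0 : (0 : ℝ) < m := by exact_mod_cast hm
  have hm0' : (0 : ℝ) < m' := by exact_mod_cast hm'
  rcases lt_or_gt_of_ne hne with h | h
  · have hlt : (m : ℝ) < m' := by exact_mod_cast h
    have h1 := sub_div_le_log_sub_log_subArith hm0' hm0
    have hδ : 0 < ((m' : ℝ) - m) / m' := div_pos (by linarith) hm0'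
    have hne' : (m' : ℝ) - m ≠ 0 := (sub_pos.mpr hlt).ne'
    rw [abs_sub_comm (Real.log m) (Real.log m'), abs_sub_comm (m : ℝ) (m' : ℝ),
      abs_of_pos (sub_pos.mpr hlt), abs_of_pos (hδ.trans_le h1)]
    calc 1 / (Real.log m' - Real.log m) ≤ 1 / (((m' : ℝ) - m) / m') :=
          one_div_le_one_div_of_le hδ h1
      _ = (m : ℝ) / ((m' : ℝ) - m) + 1 := by
          rw [one_div_div]
          field_simp
          ring
  · have hlt : (m' : ℝ) < m := by exact_mod_cast h
    have h1 := sub_div_le_log_sub_log_subArith hm0 hm0'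
    have hδ : 0 < ((m : ℝ) - m') / m := div_pos (by linarith) hm0
    rw [abs_of_pos (sub_pos.mpr hlt), abs_of_pos (hδ.trans_le h1)]
    calc 1 / (Real.log m - Real.log m') ≤ 1 / (((m : ℝ) - m') / m) :=
          one_div_le_one_div_of_le hδ h1
      _ = (m : ℝ) / ((m : ℝ) - m') := one_div_div _ _
      _ ≤ (m : ℝ) / ((m : ℝ) - m') + 1 := by linarith

-- adapted from Theorems/WeilCombCombSubcriticalStubCore.lean (`sum_erase_inv_abs_sub_le`)
/-- `Σ_{m' ≤ M, m' ≠ m} 1/|m − m'| ≤ 2 (1 + log M)` for `m ≤ M` (two harmonic sums). -/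
private theorem sum_erase_inv_abs_sub_le_subArith {M m : ℕ} (hmM : m ≤ M) :
    ∑ m' ∈ (Finset.Icc 1 M).erase m, 1 / |(m : ℝ) - m'| ≤ 2 * (1 + Real.log M) := by
  -- `1/|m - m'| = 1/(m - m' : ℕ) + 1/(m' - m : ℕ)` (one of the two is `1/0 = 0`)
  have hsplit : ∀ m' : ℕ,
      1 / |(m : ℝ) - m'| = 1 / ((m - m' : ℕ) : ℝ) + 1 / ((m' - m : ℕ) : ℝ) := by
    intro m'
    rcases le_or_gt m m' with h | h
    · rw [Nat.sub_eq_zero_of_le h, Nat.cast_zero, div_zero, zero_add, Nat.cast_sub h,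
        abs_sub_comm, abs_of_nonneg (sub_nonneg.mpr (by exact_mod_cast h))]
    · rw [Nat.sub_eq_zero_of_le h.le, Nat.cast_zero, div_zero, add_zero, Nat.cast_sub h.le,
        abs_of_nonneg (sub_nonneg.mpr (by exact_mod_cast h.le))]
  simp_rw [hsplit, Finset.sum_add_distrib, two_mul]
  exact add_le_add
    (sum_one_div_le_log_subArith (fun m' => m - m') (fun x _ y _ h0 h => by omega)
      fun x _ => by omega)
    (sum_one_div_le_log_subArith (fun m' => m' - m) (fun x _ y _ h0 h => by omega) fun x hx =>
      (Nat.sub_le x m).trans (Finset.mem_Icc.mp (Finset.mem_of_mem_erase hx)).2)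

-- adapted from Theorems/WeilCombCombSubcriticalStubCore.lean (`rowsum_le`)
/-- Row sums of the kernel: `Σ_{m' ≠ m} 1/|log m − log m'| ≤ 3M + 2 m log m` for `m ∈ Icc 1 M`. -/
private theorem rowsum_le_subArith {M m : ℕ} (hm : m ∈ Finset.Icc 1 M) :
    ∑ m' ∈ (Finset.Icc 1 M).erase m, 1 / |Real.log m - Real.log m'| ≤
      3 * M + 2 * ((m : ℝ) * Real.log m) := by
  obtain ⟨hm1, hmM⟩ := Finset.mem_Icc.mp hm
  have hm0 : (0 : ℝ) < m := by exact_mod_cast hm1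
  have hM0 : (0 : ℝ) < M := by exact_mod_cast hm1.trans hmM
  calc ∑ m' ∈ (Finset.Icc 1 M).erase m, 1 / |Real.log m - Real.log m'|
      ≤ ∑ m' ∈ (Finset.Icc 1 M).erase m, ((m : ℝ) * (1 / |(m : ℝ) - m'|) + 1) := by
        refine Finset.sum_le_sum fun m' hm' => ?_
        obtain ⟨hne, hm'⟩ := Finset.mem_erase.mp hm'
        rw [mul_one_div]
        exact inv_abs_log_sub_le_subArith hm1 (Finset.mem_Icc.mp hm').1 hne.symm
    _ = (m : ℝ) * ∑ m' ∈ (Finset.Icc 1 M).erase m, 1 / |(m : ℝ) - m'| +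
          ((Finset.Icc 1 M).erase m).card := by
        rw [Finset.sum_add_distrib, Finset.mul_sum, Finset.sum_const, nsmul_eq_mul, mul_one]
    _ ≤ (m : ℝ) * (2 * (1 + Real.log M)) + M := by
        have hcard : (((Finset.Icc 1 M).erase m).card : ℝ) ≤ M := by
          have h := Finset.card_erase_le (s := Finset.Icc 1 M) (a := m)
          rw [Nat.card_Icc] at h
          exact_mod_cast h.trans (by omega)
        linarith [mul_le_mul_of_nonneg_left (sum_erase_inv_abs_sub_le_subArith hmM) hm0.le]
    _ ≤ 3 * M + 2 * ((m : ℝ) * Real.log m) := by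
        -- `m (log M - log m) ≤ M - m`
        have h := sub_div_le_log_sub_log_subArith hm0 hM0
        rw [div_le_iff₀ hm0] at h
        nlinarith [h]

/-! ### The off-diagonal Schur bound and the Helson potential bound -/

-- adapted from Theorems/WeilCombCombSubcriticalStubCore.lean (`offdiag_le`)
/-- Off-diagonal term (Schur test with AM–GM and the row-sum bound):
`B_abs ≤ Σ_m ‖a_m‖² R_m ≤ 3M ‖a‖² + 2 Σ_m m log m ‖a_m‖²`. -/
private theorem offdiag_le_subArith (M : ℕ) (a : ℕ → ℂ) :
    ∑ m ∈ Finset.Icc 1 M, ∑ m' ∈ (Finset.Icc 1 M).erase m,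
        ‖a m‖ * ‖a m'‖ / |Real.log m - Real.log m'| ≤
      3 * M * (∑ m ∈ Finset.Icc 1 M, ‖a m‖ ^ 2) +
        2 * ∑ m ∈ Finset.Icc 1 M, (m : ℝ) * Real.log m * ‖a m‖ ^ 2 := by
  set S := Finset.Icc 1 M with hS
  -- symmetry of the off-diagonal index set and of the kernel
  have hsymm : ∑ m ∈ S, ∑ m' ∈ S.erase m, ‖a m'‖ ^ 2 / |Real.log m - Real.log m'| =
      ∑ m ∈ S, ∑ m' ∈ S.erase m, ‖a m‖ ^ 2 / |Real.log m - Real.log m'| := by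
    rw [Finset.sum_comm' (t' := S) (s' := fun m' => S.erase m')]
    · refine Finset.sum_congr rfl fun m _ => Finset.sum_congr rfl fun m' _ => ?_
      rw [abs_sub_comm]
    · intro m m'
      simp only [Finset.mem_erase]
      exact ⟨fun ⟨h1, h2, h3⟩ => ⟨⟨fun h => h2 h.symm, h1⟩, h3⟩,
        fun ⟨⟨h1, h2⟩, h3⟩ => ⟨h2, fun h => h1 h.symm, h3⟩⟩
  calc ∑ m ∈ S, ∑ m' ∈ S.erase m, ‖a m‖ * ‖a m'‖ / |Real.log m - Real.log m'|
      ≤ ∑ m ∈ S, ∑ m' ∈ S.erase m, (‖a m‖ ^ 2 / |Real.log m - Real.log m'| / 2 +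
          ‖a m'‖ ^ 2 / |Real.log m - Real.log m'| / 2) := by
        refine Finset.sum_le_sum fun m _ => Finset.sum_le_sum fun m' _ => ?_
        have ht : 0 ≤ (|Real.log m - Real.log m'|)⁻¹ := inv_nonneg.mpr (abs_nonneg _)
        simp only [div_eq_mul_inv]
        nlinarith [mul_nonneg ht (sq_nonneg (‖a m‖ - ‖a m'‖))]
    _ = ∑ m ∈ S, ∑ m' ∈ S.erase m, ‖a m‖ ^ 2 / |Real.log m - Real.log m'| := by
        simp only [Finset.sum_add_distrib, ← Finset.sum_div, hsymm]
        ring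
    _ = ∑ m ∈ S, ‖a m‖ ^ 2 * ∑ m' ∈ S.erase m, 1 / |Real.log m - Real.log m'| := by
        refine Finset.sum_congr rfl fun m _ => ?_
        rw [Finset.mul_sum]
        exact Finset.sum_congr rfl fun m' _ => by rw [mul_one_div]
    _ ≤ ∑ m ∈ S, ‖a m‖ ^ 2 * (3 * M + 2 * ((m : ℝ) * Real.log m)) :=
        Finset.sum_le_sum fun m hm =>
          mul_le_mul_of_nonneg_left (rowsum_le_subArith hm) (sq_nonneg _)
    _ = 3 * M * (∑ m ∈ S, ‖a m‖ ^ 2) + 2 * ∑ m ∈ S, (m : ℝ) * Real.log m * ‖a m‖ ^ 2 := by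
        rw [Finset.mul_sum, Finset.mul_sum, ← Finset.sum_add_distrib]
        exact Finset.sum_congr rfl fun m _ => by ring

-- adapted from Theorems/WeilCombCombSubcriticalStubCore.lean (`helson_le`), with the sharp
-- Rosser–Schoenfeld constant of Theorems/WeilCombCombHelsonBound.lean
/-- Helson potential: `Σ_m ‖a_m‖² (log m + ψ₁(M/m)) ≤ (log M + 1) ‖a‖²`
(termwise `log m + ψ₁(M/m) ≤ log M + 1`, `WeilComb.log_add_sum_vonMangoldt_div_le`). -/
private theorem helson_le_subArith (M : ℕ) (a : ℕ → ℂ) :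
    ∑ m ∈ Finset.Icc 1 M, ‖a m‖ ^ 2 *
        (Real.log m + ∑ n ∈ Finset.Icc 1 (M / m), (ArithmeticFunction.vonMangoldt n : ℝ) / n) ≤
      (Real.log M + 1) * ∑ m ∈ Finset.Icc 1 M, ‖a m‖ ^ 2 := by
  rw [Finset.mul_sum]
  refine Finset.sum_le_sum fun m hm => ?_
  rw [mul_comm]
  exact mul_le_mul_of_nonneg_right (WeilComb.log_add_sum_vonMangoldt_div_le hm) (sq_nonneg _)

/-! ### The stub -/

/-- **Stub `stub_subArith` — explicit divisor-graph inequalities of the effective subcritical window.**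
For every `M` and `a`: (1) multiscale Poincaré `Q' ≤ 2M·D + 2(log 4 + 4)·M·L`
(`stub_poincare_explicit`); (2) near-diagonal Schur bound `B_abs ≤ 3M·L + 2Q'`; (3) pole shadow
`(A₋A₊)² ≤ 4M·L·(M·L + Q')` (`stub_polarCS`); (4) Helson potential
`Σ_m ‖a_m‖²(log m + ψ₁(M/m)) ≤ (log M + 1)·L` (Rosser–Schoenfeld). -/
theorem stub_subArith : ∀ (M : ℕ) (a : ℕ → ℂ),
    (∑ m ∈ Finset.Icc 1 M, (m : ℝ) * Real.log m * ‖a m‖ ^ 2 ≤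
        2 * M * (∑ m ∈ Finset.Icc 1 M, ∑ n ∈ Finset.Icc 1 (M / m),
            (ArithmeticFunction.vonMangoldt n : ℝ) * ‖a (n * m) - ((Real.sqrt n : ℂ))⁻¹ * a m‖ ^ 2) +
          2 * (Real.log 4 + 4) * M * ∑ m ∈ Finset.Icc 1 M, ‖a m‖ ^ 2) ∧
    (∑ m ∈ Finset.Icc 1 M, ∑ m' ∈ (Finset.Icc 1 M).erase m,
          ‖a m‖ * ‖a m'‖ / |Real.log m - Real.log m'| ≤
        3 * M * (∑ m ∈ Finset.Icc 1 M, ‖a m‖ ^ 2) +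
          2 * ∑ m ∈ Finset.Icc 1 M, (m : ℝ) * Real.log m * ‖a m‖ ^ 2) ∧
    (((∑ m ∈ Finset.Icc 1 M, ‖a m‖ / Real.sqrt m) * (∑ m ∈ Finset.Icc 1 M, ‖a m‖ * Real.sqrt m)) ^ 2 ≤
        4 * M * (∑ m ∈ Finset.Icc 1 M, ‖a m‖ ^ 2) *
          (M * (∑ m ∈ Finset.Icc 1 M, ‖a m‖ ^ 2) +
            ∑ m ∈ Finset.Icc 1 M, (m : ℝ) * Real.log m * ‖a m‖ ^ 2)) ∧
    (∑ m ∈ Finset.Icc 1 M, ‖a m‖ ^ 2 *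
          (Real.log m + ∑ n ∈ Finset.Icc 1 (M / m), (ArithmeticFunction.vonMangoldt n : ℝ) / n) ≤
        (Real.log M + 1) * ∑ m ∈ Finset.Icc 1 M, ‖a m‖ ^ 2) :=
  fun M a => ⟨stub_poincare_explicit M a, offdiag_le_subArith M a, stub_polarCS M a,
    helson_le_subArith M a⟩

end Summit.RiemannHypothesis.RiemannHypothesis.Theorems.WeilCombBohrFejer

end
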